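import Summits.AtomisticToContinuum.Crystallization.Theorems.FrustratedLawDichotomyStrainedPatchHomLeafTableCheckP

/-!
# Param-form leaf — the RADIUS-GENERIC FOLD INVARIANT (integer layer of the soundness proof of `leafCheckP`)

decomp-a2c hand-1 g23 (crux `AperiodicFrustratedLawGap`, stmt-AtomisticToContinuum-27623; critic row 882).  DEF-FREE.  Verbatim twin of hand-1 g20's
`…HomLeafTableFold` for the radius-generic fold `foldNLR tab k r` of `…HomLeafTableCheckP` (the landed `step1 … step4` with the range radius supplied by a
function `r : NL → ℕ`; the param-form leaf uses `r = radP k e`): (i) failure is absorbing, hence a passing leaf has every visited label FAR-skipped or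
TREATED; (ii) the accumulator of a passing fold is the fieldwise SUM of the per-label increments `incrR`; (iii) `foldNLR` is the left fold of `stepR` over
the visited prefix.  0 sorry; standard axioms.  `--supports stmt-AtomisticToContinuum-27623`.
-/

namespace Summit.AtomisticToContinuum.Crystallization.Theorems.FrustratedLawDichotomyStrainedPatchHomLeafTableCheck

/-! ## §1. Elementary facts about the radius-generic step -/

/-- Unfolding of the step into the proof-side predicates. [formal bookkeeping] -/
theorem stepR_unfold (tab : QT) (k : LK) (r : NL → ℕ) (a : Acc) (l : NL) :
    stepR tab k r a l =
      (match Nat.ble (qNeg k l + r l) (qPos k l) with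
        | true => (match farBR k r l with
          | true => a
          | false => (match rowOf tab k l with
            | none => a.fail
            | some row => (match rangeBR k r l row with
              | true => step4 a l (r l) row (q0N k l - row.t)
              | false => a.fail)))
        | false => a.fail) := by
  rfl

/-- A treatedR label adds its increment. [formal bookkeeping] -/
theorem stepR_of_treated {tab : QT} {k : LK} {r : NL → ℕ} {l : NL} (h : treatedR tab k r l = true) (a : Acc) : stepR tab k r a l = a.add (incrR tab k r l) := by
  rw [stepR_unfold]
  unfold incrR
  rw [h]
  unfold treatedR at h
  cases h1 : Nat.ble (qNeg k l + r l) (qPos k l)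
  · rw [h1] at h; simp at h
  · rw [h1] at h
    cases h2 : farBR k r l
    · rw [h2] at h
      cases h3 : rowOf tab k l with
      | none => rw [h3] at h; simp at h
      | some row =>
        rw [h3] at h
        simp only [Bool.true_and, Bool.not_false] at h
        simp only [h]
        exact step4_eq_add a l (r l) row _
    · rw [h2] at h; simp at h

/-- A passing, untreated label is far-skipped: the accumulator is unchanged. [formal bookkeeping] -/
theorem stepR_of_far {tab : QT} {k : LK} {r : NL → ℕ} {l : NL} (hs : stepOKR tab k r l = true) (ht : treatedR tab k r l = false) (a : Acc) : stepR tab k r a l = a := by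
  rw [stepR_unfold]
  unfold stepOKR at hs
  unfold treatedR at ht
  cases h1 : Nat.ble (qNeg k l + r l) (qPos k l)
  · rw [h1] at hs; simp at hs
  · rw [h1] at hs ht
    cases h2 : farBR k r l
    · rw [h2] at hs ht
      simp only [Bool.true_and, Bool.false_or, Bool.not_false] at hs ht
      cases h3 : rowOf tab k l with
      | none => rw [h3] at hs; simp at hs
      | some row => rw [h3] at hs ht; simp only at hs ht; rw [hs] at ht; simp at ht
    · rfl

/-- A failing label sets `ok := false`. [formal bookkeeping] -/
theorem ok_stepR_of_not_stepOKR {tab : QT} {k : LK} {r : NL → ℕ} {l : NL} (hs : stepOKR tab k r l = false) (a : Acc) : (stepR tab k r a l).ok = false := by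
  rw [stepR_unfold]
  unfold stepOKR at hs
  cases h1 : Nat.ble (qNeg k l + r l) (qPos k l)
  · rfl
  · rw [h1] at hs
    cases h2 : farBR k r l
    · rw [h2] at hs
      simp only [Bool.true_and, Bool.false_or] at hs
      cases h3 : rowOf tab k l with
      | none => rfl
      | some row =>
        rw [h3] at hs; simp only at hs
        simp only [hs]
        rfl
    · rw [h2] at hs; simp at hs

/-- Failure is absorbing for one step. [formal bookkeeping] -/
theorem ok_stepR_of_fail {tab : QT} {k : LK} {r : NL → ℕ} {a : Acc} {l : NL} (h : a.ok = false) : (stepR tab k r a l).ok = false := by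
  cases hs : stepOKR tab k r l
  · exact ok_stepR_of_not_stepOKR hs a
  · cases ht : treatedR tab k r l
    · rw [stepR_of_far hs ht]; exact h
    · rw [stepR_of_treated ht]; simp [Acc.add, h]

/-! ## §2. The fold -/

/-- `foldNLR` is the left fold of `step` over the visited prefix. [formal bookkeeping] -/
theorem foldNLR_eq (tab : QT) (k : LK) (r : NL → ℕ) (nstop : ℕ) : ∀ (ls : List NL) (a : Acc),
    foldNLR tab k r nstop a ls = (visited nstop ls).foldl (stepR tab k r) a
  | [], a => rfl
  | l :: ls, a => by
    unfold foldNLR visited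
    cases Nat.ble nstop l.n
    · simp only [List.foldl_cons]; exact foldNLR_eq tab k r nstop ls _
    · rfl

/-- Failure is absorbing for the fold. [formal bookkeeping] -/
theorem ok_foldlR_of_fail (tab : QT) (k : LK) (r : NL → ℕ) : ∀ (ls : List NL) (a : Acc), a.ok = false → (ls.foldl (stepR tab k r) a).ok = false
  | [], _, h => h
  | _ :: ls, _, h => ok_foldlR_of_fail tab k r ls _ (ok_stepR_of_fail h)

/-- ★ **THE FOLD INVARIANT.**  If the fold passes (`ok = true` at the end) then it started with `ok = true`, every label of the list passes its step, and the
final accumulator is the start plus the increments of the treatedR labels, added in order. [formal bookkeeping] -/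
theorem foldl_stepR_eq (tab : QT) (k : LK) (r : NL → ℕ) : ∀ (ls : List NL) (a : Acc), (ls.foldl (stepR tab k r) a).ok = true →
    a.ok = true ∧ (∀ l ∈ ls, stepOKR tab k r l = true) ∧
      ls.foldl (stepR tab k r) a = (ls.filter (fun l => treatedR tab k r l)).foldl (fun acc l => acc.add (incrR tab k r l)) a
  | [], a, h => ⟨h, fun _ hl => (List.not_mem_nil hl).elim, rfl⟩
  | l :: ls, a, h => by
    rw [List.foldl_cons] at h
    cases hs : stepOKR tab k r l
    · have := ok_foldlR_of_fail tab k r ls _ (ok_stepR_of_not_stepOKR hs a)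
      rw [h] at this; exact Bool.noConfusion this
    · obtain ⟨hok, hall, heq⟩ := foldl_stepR_eq tab k r ls _ h
      refine ⟨?_, ?_, ?_⟩
      · cases ht : treatedR tab k r l
        · rwa [stepR_of_far hs ht] at hok
        · rw [stepR_of_treated ht] at hok
          simp only [Acc.add, Bool.and_eq_true] at hok
          exact hok.1
      · intro l' hl'
        rcases List.mem_cons.1 hl' with rfl | hmem
        · exact hs
        · exact hall l' hmem
      · rw [List.foldl_cons, List.filter_cons]
        cases ht : treatedR tab k r l
        · simp only [Bool.false_eq_true, ite_false]
          rw [stepR_of_far hs ht] at heq ⊢; exact heq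
        · simp only [ite_true, List.foldl_cons]
          rw [stepR_of_treated ht] at heq ⊢; exact heq


end Summit.AtomisticToContinuum.Crystallization.Theorems.FrustratedLawDichotomyStrainedPatchHomLeafTableCheck
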